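import Literature.Algebra.EuclideanLattices.RegevPointSet
import Literature.Algebra.EuclideanLattices.IntegerBallBudgetRegion
import HarnessLib

/-!
# Regev 2004, §3.3: ranking and unranking the quantised ball in lexicographic order

Topic `Algebra/EuclideanLattices` (family `pqc`); proved material towards the discharge of the
named fact `Literature.Algebra.EuclideanLattices.usvp_of_dihedralCoset` (O. Regev, *Quantum
computation and lattice problems*, SIAM J. Comput. 33 (2004) 738–760, Thm. 1.1). No named fact is
introduced; everything is proved.

`RegevPointSet.lean` replaces the state `|η⟩` of Regev's Lemma 3.11 (uniform superposition over the
grid points of a ball, prepared there only approximately) by the uniform superposition over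
`pointSet n Q Δ = lexPrefix (qBall n Q Δ) 2^κ`, the `2^κ` lexicographically smallest points of the
quantised ball `qBall n Q Δ = {x ∈ ℤⁿ | ∑ᵢ ⌈xᵢ²/Δ⌉ ≤ Q}`, indexed by
`nthLex (qBall n Q Δ) : Fin |qBall| → ℤⁿ` (`Finset.orderEmbOfFin`, an abstract order isomorphism).
Preparing that state from `κ` Hadamard coins `|i⟩ ↦ |nthLex _ i⟩` requires a POLYNOMIAL-TIME
UNRANKING of the quantised ball; this file supplies the combinatorics of it (the classical
rank/unrank scheme by cumulative counts, for a separable body whose coordinate range is exponential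
but carries only `Q + 1` weight levels):

* `lexRank S x = #{y ∈ S | y <ₗₑₓ x}` and the characterisation of `nthLex` by it
  (`lexRank_nthLex`, `nthLex_lexRank`, `nthLex_eq_iff`);
* the fibre decomposition of the quantised ball over the first coordinate
  (`cons_mem_qBall_iff`, `qBall_succ`, `card_filter_qBall_succ`) and the rank recursion
  `lexRank (qBall (m+1) Q Δ) (v :: y) = below m Q Δ v + lexRank (qBall m (Q − ⌈v²/Δ⌉) Δ) y`
  (`lexRank_qBall_cons`), `below m Q Δ v = ∑_{w < v admissible} |qBall m (Q − ⌈w²/Δ⌉) Δ|`;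
* the level structure: `⌈w²/Δ⌉ ≤ j ↔ |w| ≤ bLev Δ j = ⌊√(jΔ)⌋` (`qWeight_le_iff`), so the
  admissible first coordinates `[−bLev Δ Q, bLev Δ Q]` split, in increasing order, into `2Q + 1`
  BANDS of constant weight (`bandStart`, `bandLevel`, `bandLen`; levels `Q, …, 1` on the negative
  side, `0`, then `1, …, Q`), on each of which `below` is an arithmetic progression
  (`below_bandStart`, `below_bandStart_add`);
* the grouped counting recursion `|qBall (m+1) Q Δ| = ∑_{k ≤ 2Q} bandLen · |qBall m (Q − level)|`
  (`card_qBall_succ_eq_sum_bandSize`, `card_qBall_zero`) — `Q + 1` distinct terms, each a product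
  of numbers of polynomially many bits, so that the table `(m', q) ↦ |qBall m' q Δ|`, `m' ≤ n`,
  `q ≤ Q`, is a polynomial-time dynamic programme;
* the explicit unranking `unrank Δ m Q i : Fin m → ℤ` (find the band of `i` by cumulative band
  sizes — `BudgetRegion.blockUnrank` of `IntegerBallBudgetRegion.lean` —, divide the offset by the
  fibre size to get the coordinate and the residual index, recurse) and its correctness
  **`unrank_eq_nthLex`**: `unrank Δ m Q i = nthLex (qBall m Q Δ) i` for `i < |qBall m Q Δ|`
  (with `unrank_mem`, `lexRank_unrank`).

Only arithmetic on the numbers `bLev Δ j` (`j ≤ Q`), the table entries and the index is used by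
`unrank`, which is what a reversible/`FP` implementation mirrors.

## References

* O. Regev, *Quantum computation and lattice problems*, SIAM J. Comput. 33 (2004) 738–760,
  Lemma 3.11 (the state `|η⟩` over the grid points of a ball; here: exact unranking of the
  quantised variant) [Regev2004].
* A. Nijenhuis, H. S. Wilf, *Combinatorial Algorithms*, 2nd ed., Academic Press 1978, Ch. 13
  (ranking and unranking by cumulative counts). (Standard; fully proved here.)
-/

noncomputable section

namespace Literature.Algebra.EuclideanLattices

namespace Regev2004

open Finset

variable {n : ℕ}

/-! ### The lexicographic rank and the characterisation of `nthLex` -/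

/-- The lexicographic rank of `x` in `S`: the number of elements of `S` strictly below `x` in the
lexicographic order (first coordinate most significant). [folklore] -/
def lexRank (S : Finset (Fin n → ℤ)) (x : Fin n → ℤ) : ℕ := (S.filter fun y => toLex y < toLex x).card

/-- The elements of `S` below `nthLex S i` are exactly the `nthLex S j`, `j < i`. [folklore] -/
theorem filter_lt_nthLex_eq_image (S : Finset (Fin n → ℤ)) (i : Fin S.card) :
    S.filter (fun y => toLex y < toLex (nthLex S i)) = (Finset.Iio i).image (nthLex S) := by
  ext y
  simp only [mem_filter, mem_image, mem_Iio]
  constructor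
  · rintro ⟨hy, hlt⟩
    obtain ⟨j, rfl⟩ := exists_nthLex_eq hy
    refine ⟨j, ?_, rfl⟩
    by_contra hji
    rcases (not_lt.1 hji).lt_or_eq with h | h
    · exact lt_asymm hlt (toLex_nthLex_lt h)
    · rw [h] at hlt
      exact lt_irrefl _ hlt
  · rintro ⟨j, hj, rfl⟩
    exact ⟨nthLex_mem S j, toLex_nthLex_lt hj⟩

/-- **`nthLex S i` has rank `i`.** [folklore] -/
theorem lexRank_nthLex (S : Finset (Fin n → ℤ)) (i : Fin S.card) : lexRank S (nthLex S i) = i := by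
  rw [lexRank, filter_lt_nthLex_eq_image, card_image_of_injective _ (nthLex_injective S), Fin.card_Iio]

/-- The rank of an element is below the cardinality. [folklore] -/
theorem lexRank_lt_card {S : Finset (Fin n → ℤ)} {x : Fin n → ℤ} (hx : x ∈ S) : lexRank S x < S.card := by
  obtain ⟨i, rfl⟩ := exists_nthLex_eq hx
  rw [lexRank_nthLex]
  exact i.isLt

/-- **An element of `S` is the `lexRank`-th one.** [folklore] -/
theorem nthLex_lexRank {S : Finset (Fin n → ℤ)} {x : Fin n → ℤ} (hx : x ∈ S) :
    nthLex S ⟨lexRank S x, lexRank_lt_card hx⟩ = x := by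
  obtain ⟨i, rfl⟩ := exists_nthLex_eq hx
  congr 1
  exact Fin.ext (lexRank_nthLex S i)

/-- **Characterisation of `nthLex`**: `nthLex S i = x` iff `x ∈ S` has rank `i`. [folklore] -/
theorem nthLex_eq_iff {S : Finset (Fin n → ℤ)} (i : Fin S.card) (x : Fin n → ℤ) :
    nthLex S i = x ↔ x ∈ S ∧ lexRank S x = i := by
  constructor
  · rintro rfl
    exact ⟨nthLex_mem S i, lexRank_nthLex S i⟩
  · rintro ⟨hx, hr⟩
    rw [← nthLex_lexRank hx]
    congr 1
    exact Fin.ext hr.symm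

/-! ### Head and tail of integer vectors, and the lexicographic order -/

/-- `consV w y = w :: y`: `Fin.cons` at the constant family `ℤ` (a non-dependent abbreviation, so
that `consV w` is a plain map `ℤᵐ → ℤᵐ⁺¹`). [folklore] -/
def consV {m : ℕ} (w : ℤ) (y : Fin m → ℤ) : Fin (m + 1) → ℤ := Fin.cons w y

/-- Head of `consV`. [folklore] -/
@[simp] theorem consV_zero {m : ℕ} (w : ℤ) (y : Fin m → ℤ) : consV w y 0 = w := rfl

/-- Tail entries of `consV`. [folklore] -/
@[simp] theorem consV_succ {m : ℕ} (w : ℤ) (y : Fin m → ℤ) (i : Fin m) : consV w y i.succ = y i := by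
  simp [consV]

/-- The tail of `consV`. [folklore] -/
@[simp] theorem tail_consV {m : ℕ} (w : ℤ) (y : Fin m → ℤ) : Fin.tail (consV w y) = y := Fin.tail_cons _ _

/-- A vector is its head consed to its tail. [folklore] -/
@[simp] theorem consV_self_tail {m : ℕ} (x : Fin (m + 1) → ℤ) : consV (x 0) (Fin.tail x) = x := Fin.cons_self_tail x

/-- `consV w` is injective. [folklore] -/
theorem consV_injective {m : ℕ} (w : ℤ) : Function.Injective (consV (m := m) w) := fun y₁ y₂ h => by
  have := congrArg Fin.tail h
  simpa using this

/-- Lexicographic comparison of two vectors given by head and tail. [folklore] -/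
theorem toLex_consV_lt_consV_iff {m : ℕ} (a b : ℤ) (x y : Fin m → ℤ) :
    toLex (consV a x) < toLex (consV b y) ↔ a < b ∨ (a = b ∧ toLex x < toLex y) := by
  change Pi.Lex (· < ·) (· < ·) _ _ ↔ a < b ∨ (a = b ∧ Pi.Lex (· < ·) (· < ·) x y)
  constructor
  · rintro ⟨i, hi, hlt⟩
    induction i using Fin.cases with
    | zero =>
      left
      simpa using hlt
    | succ k =>
      right
      refine ⟨by simpa using hi 0 (Fin.succ_pos k), k, fun j hj => ?_, by simpa using hlt⟩
      simpa using hi j.succ (Fin.succ_lt_succ_iff.2 hj)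
  · rintro (h | ⟨rfl, k, hk, hlt⟩)
    · exact ⟨0, fun j hj => absurd hj (Fin.not_lt_zero j), by simpa using h⟩
    · refine ⟨k.succ, fun j hj => ?_, by simpa using hlt⟩
      induction j using Fin.cases with
      | zero => simp
      | succ j => simpa using hk j (Fin.succ_lt_succ_iff.1 hj)

/-- Lexicographic comparison of a vector with one given by head and tail. [folklore] -/
theorem toLex_lt_consV_iff {m : ℕ} (z : Fin (m + 1) → ℤ) (b : ℤ) (y : Fin m → ℤ) :
    toLex z < toLex (consV b y) ↔ z 0 < b ∨ (z 0 = b ∧ toLex (Fin.tail z) < toLex y) := by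
  conv_lhs => rw [← consV_self_tail z]
  exact toLex_consV_lt_consV_iff _ _ _ _

/-! ### Levels of the quantised weight -/

/-- The level boundaries `bLev Δ j = ⌊√(jΔ)⌋`: `⌈w²/Δ⌉ ≤ j ↔ |w| ≤ bLev Δ j`. [folklore] -/
def bLev (Δ j : ℕ) : ℕ := Nat.sqrt (j * Δ)

/-- `bLev Δ 0 = 0`. [folklore] -/
@[simp] theorem bLev_zero (Δ : ℕ) : bLev Δ 0 = 0 := by simp [bLev]

/-- `bLev` is monotone in the level. [folklore] -/
theorem bLev_mono (Δ : ℕ) {i j : ℕ} (h : i ≤ j) : bLev Δ i ≤ bLev Δ j :=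
  Nat.sqrt_le_sqrt (Nat.mul_le_mul_right _ h)

/-- **The level sets of the quantised weight**: `⌈w²/Δ⌉ ≤ j ↔ |w| ≤ ⌊√(jΔ)⌋` (`Δ ≥ 1`). [folklore] -/
theorem qWeight_le_iff {Δ : ℕ} (hΔ : 0 < Δ) (w : ℤ) (j : ℕ) : qWeight Δ w ≤ j ↔ w.natAbs ≤ bLev Δ j := by
  rw [bLev, Nat.le_sqrt', qWeight]
  constructor
  · intro h
    have h1 : (w.natAbs ^ 2 + (Δ - 1)) / Δ * Δ ≤ j * Δ := Nat.mul_le_mul_right _ h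
    have h2 := Nat.div_add_mod (w.natAbs ^ 2 + (Δ - 1)) Δ
    have h3 := Nat.mod_lt (w.natAbs ^ 2 + (Δ - 1)) hΔ
    rw [Nat.mul_comm] at h1
    omega
  · intro h
    calc (w.natAbs ^ 2 + (Δ - 1)) / Δ ≤ (j * Δ + (Δ - 1)) / Δ := Nat.div_le_div_right (by omega)
      _ = j := by
          rw [Nat.add_div_of_dvd_right ⟨j, by ring⟩, Nat.mul_div_cancel _ hΔ,
            Nat.div_eq_of_lt (Nat.sub_lt hΔ Nat.one_pos), Nat.add_zero]

/-- `⌈w²/Δ⌉ = 0 ↔ w = 0`. [folklore] -/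
theorem qWeight_eq_zero_iff {Δ : ℕ} (hΔ : 0 < Δ) (w : ℤ) : qWeight Δ w = 0 ↔ w = 0 := by
  rw [← Nat.le_zero, qWeight_le_iff hΔ, bLev_zero, Nat.le_zero, Int.natAbs_eq_zero]

/-- `⌈w²/Δ⌉ = j + 1 ↔ bLev Δ j < |w| ≤ bLev Δ (j+1)`. [folklore] -/
theorem qWeight_eq_succ_iff {Δ : ℕ} (hΔ : 0 < Δ) (w : ℤ) (j : ℕ) :
    qWeight Δ w = j + 1 ↔ bLev Δ j < w.natAbs ∧ w.natAbs ≤ bLev Δ (j + 1) := by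
  have h1 := qWeight_le_iff hΔ w j
  have h2 := qWeight_le_iff hΔ w (j + 1)
  constructor
  · intro h
    exact ⟨not_le.1 fun h' => by have := h1.2 h'; omega, h2.1 h.le⟩
  · rintro ⟨ha, hb⟩
    have := h2.2 hb
    have : ¬ qWeight Δ w ≤ j := fun h' => not_le.2 ha (h1.1 h')
    omega

/-! ### Fibres of the quantised ball over the first coordinate -/

/-- The weight of a vector given by head and tail. [folklore] -/
theorem sum_qWeight_consV {m : ℕ} (Δ : ℕ) (v : ℤ) (y : Fin m → ℤ) :
    ∑ i, qWeight Δ (consV v y i) = qWeight Δ v + ∑ i, qWeight Δ (y i) := by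
  rw [Fin.sum_univ_succ]
  simp only [consV_zero, consV_succ]

/-- **Fibres**: `v :: y ∈ qBall (m+1) Q Δ ↔ ⌈v²/Δ⌉ ≤ Q ∧ y ∈ qBall m (Q − ⌈v²/Δ⌉) Δ`. [folklore] -/
theorem consV_mem_qBall_iff {m Δ : ℕ} (hΔ : 0 < Δ) (Q : ℕ) (v : ℤ) (y : Fin m → ℤ) :
    consV v y ∈ qBall (m + 1) Q Δ ↔ qWeight Δ v ≤ Q ∧ y ∈ qBall m (Q - qWeight Δ v) Δ := by
  rw [mem_qBall_iff hΔ, mem_qBall_iff hΔ, sum_qWeight_consV]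
  omega

/-- The admissible first coordinates: `[−bLev Δ Q, bLev Δ Q]`. [folklore] -/
def adm (Q Δ : ℕ) : Finset ℤ := Finset.Icc (-(bLev Δ Q : ℤ)) (bLev Δ Q)

/-- Membership in `adm` is the weight condition `⌈w²/Δ⌉ ≤ Q`. [folklore] -/
theorem mem_adm_iff {Δ : ℕ} (hΔ : 0 < Δ) (Q : ℕ) (w : ℤ) : w ∈ adm Q Δ ↔ qWeight Δ w ≤ Q := by
  rw [adm, Finset.mem_Icc, qWeight_le_iff hΔ]
  omega

/-- The fibre of the quantised ball over the first coordinate `w`, consed back. [folklore] -/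
def fibreImage (Δ m Q : ℕ) (w : ℤ) : Finset (Fin (m + 1) → ℤ) :=
  (qBall m (Q - qWeight Δ w) Δ).image (consV w)

/-- **The quantised ball, fibred over the first coordinate.** [folklore] -/
theorem qBall_succ {Δ : ℕ} (hΔ : 0 < Δ) (m Q : ℕ) :
    qBall (m + 1) Q Δ = (adm Q Δ).biUnion (fibreImage Δ m Q) := by
  ext x
  simp only [mem_biUnion, fibreImage, mem_image, mem_adm_iff hΔ]
  constructor
  · intro hx
    rw [← consV_self_tail x, consV_mem_qBall_iff hΔ] at hx
    exact ⟨x 0, hx.1, Fin.tail x, hx.2, consV_self_tail x⟩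
  · rintro ⟨w, hw, y, hy, rfl⟩
    exact (consV_mem_qBall_iff hΔ Q w y).2 ⟨hw, hy⟩

/-- The (filtered) fibres over distinct first coordinates are disjoint. [folklore] -/
theorem pairwiseDisjoint_image_consV {m : ℕ} (s : Finset ℤ) (t : ℤ → Finset (Fin m → ℤ)) :
    (s : Set ℤ).PairwiseDisjoint fun w => (t w).image (consV w) := by
  intro w₁ _ w₂ _ hne
  rw [Function.onFun, Finset.disjoint_left]
  intro x hx₁ hx₂
  obtain ⟨y₁, -, rfl⟩ := mem_image.1 hx₁
  obtain ⟨y₂, -, h⟩ := mem_image.1 hx₂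
  have := congrFun h 0
  simp only [consV_zero] at this
  exact hne this.symm

/-- **Counting a property over the fibres**: `#{x ∈ qBall (m+1) Q Δ | P x} = ∑_{w admissible}
#{y ∈ qBall m (Q − ⌈w²/Δ⌉) Δ | P (w :: y)}`. [folklore] -/
theorem card_filter_qBall_succ {Δ : ℕ} (hΔ : 0 < Δ) (m Q : ℕ) (P : (Fin (m + 1) → ℤ) → Prop) [DecidablePred P] :
    ((qBall (m + 1) Q Δ).filter P).card =
      ∑ w ∈ adm Q Δ, ((qBall m (Q - qWeight Δ w) Δ).filter fun y => P (consV w y)).card := by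
  rw [qBall_succ hΔ, filter_biUnion]
  have hdisj : (adm Q Δ : Set ℤ).PairwiseDisjoint fun w =>
      ((qBall m (Q - qWeight Δ w) Δ).filter fun y => P (consV w y)).image (consV w) :=
    pairwiseDisjoint_image_consV _ _
  have hcongr : ((adm Q Δ).biUnion fun w => (fibreImage Δ m Q w).filter P) =
      (adm Q Δ).biUnion fun w => ((qBall m (Q - qWeight Δ w) Δ).filter fun y => P (consV w y)).image (consV w) :=
    biUnion_congr rfl fun w _ => filter_image
  rw [hcongr, card_biUnion hdisj]
  exact sum_congr rfl fun w _ => card_image_of_injective _ (consV_injective w)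

/-- **The counting recursion over the first coordinate**:
`|qBall (m+1) Q Δ| = ∑_{w admissible} |qBall m (Q − ⌈w²/Δ⌉) Δ|`. [folklore] -/
theorem card_qBall_succ {Δ : ℕ} (hΔ : 0 < Δ) (m Q : ℕ) :
    (qBall (m + 1) Q Δ).card = ∑ w ∈ adm Q Δ, (qBall m (Q - qWeight Δ w) Δ).card := by
  have h := card_filter_qBall_succ hΔ m Q (fun _ => True)
  simp only [filter_true_of_mem (fun _ _ => trivial)] at h
  exact h

/-- In dimension `0` the quantised ball is the one empty vector. [folklore] -/
theorem card_qBall_zero (Q Δ : ℕ) : (qBall 0 Q Δ).card = 1 := by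
  rw [Finset.card_eq_one]
  refine ⟨Fin.elim0, ?_⟩
  ext x
  simp only [qBall, mem_filter, Fintype.mem_piFinset, mem_singleton, univ_eq_empty, sum_empty, zero_le, and_true]
  exact ⟨fun _ => funext fun i => Fin.elim0 i, fun _ i => Fin.elim0 i⟩

/-! ### The rank recursion -/

/-- `below Δ m Q v`: the number of points of `qBall (m+1) Q Δ` whose first coordinate is `< v`,
as the cumulative sum of fibre sizes. [folklore] -/
def below (Δ m Q : ℕ) (v : ℤ) : ℕ :=
  ∑ w ∈ (adm Q Δ).filter (· < v), (qBall m (Q - qWeight Δ w) Δ).card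

/-- `below` counts the points with first coordinate `< v`. [folklore] -/
theorem card_filter_apply_zero_lt {Δ : ℕ} (hΔ : 0 < Δ) (m Q : ℕ) (v : ℤ) :
    ((qBall (m + 1) Q Δ).filter fun x => x 0 < v).card = below Δ m Q v := by
  rw [card_filter_qBall_succ hΔ, below, sum_filter]
  refine sum_congr rfl fun w _ => ?_
  by_cases h : w < v
  · simp [h]
  · simp [h]

/-- **The rank recursion**: for `v :: y` with `v` admissible,
`lexRank (qBall (m+1) Q Δ) (v :: y) = below v + lexRank (qBall m (Q − ⌈v²/Δ⌉) Δ) y`. [folklore] -/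
theorem lexRank_qBall_consV {Δ : ℕ} (hΔ : 0 < Δ) (m Q : ℕ) (v : ℤ) (y : Fin m → ℤ) (hv : qWeight Δ v ≤ Q) :
    lexRank (qBall (m + 1) Q Δ) (consV v y) = below Δ m Q v + lexRank (qBall m (Q - qWeight Δ v) Δ) y := by
  rw [lexRank, card_filter_qBall_succ hΔ]
  simp only [toLex_consV_lt_consV_iff]
  have hvadm : v ∈ adm Q Δ := (mem_adm_iff hΔ Q v).2 hv
  rw [← Finset.add_sum_erase _ _ hvadm]
  have h1 : ((qBall m (Q - qWeight Δ v) Δ).filter fun z => v < v ∨ v = v ∧ toLex z < toLex y).card =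
      lexRank (qBall m (Q - qWeight Δ v) Δ) y := by
    simp only [lt_irrefl, false_or, true_and]
    rfl
  rw [h1, add_comm]
  congr 1
  rw [below, sum_filter, ← Finset.add_sum_erase _ _ hvadm]
  simp only [lt_irrefl, if_false, zero_add]
  refine sum_congr rfl fun w hw => ?_
  have hne : w ≠ v := ne_of_mem_erase hw
  by_cases h : w < v
  · simp [h]
  · simp [h, hne]

/-! ### The bands of constant weight -/

/-- The weight level of the `k`-th band (`k ≤ 2Q`): `Q, Q−1, …, 1, 0, 1, …, Q`. [folklore] -/
def bandLevel (Q k : ℕ) : ℕ := (Q - k) + (k - Q)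

/-- The length of a band of level `j`: `1` for level `0` (the point `0`), `bLev Δ j − bLev Δ (j−1)`
otherwise (one of the two halves of the level set). [folklore] -/
def bandLen (Δ j : ℕ) : ℕ := if j = 0 then 1 else bLev Δ j - bLev Δ (j - 1)

/-- The first point of the `k`-th band: `−bLev Δ (Q−k)` on the negative side (`k ≤ Q`; this is `0`
for `k = Q`), `bLev Δ (k−Q−1) + 1` on the positive side. [folklore] -/
def bandStart (Δ Q k : ℕ) : ℤ := if k ≤ Q then -(bLev Δ (Q - k) : ℤ) else (bLev Δ (k - Q - 1) : ℤ) + 1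

/-- Levels are at most `Q` (for `k ≤ 2Q`). [folklore] -/
theorem bandLevel_le {Q k : ℕ} (hk : k ≤ 2 * Q) : bandLevel Q k ≤ Q := by
  unfold bandLevel; omega

/-- The level on the negative side and at the zero band. [folklore] -/
theorem bandLevel_of_le {Q k : ℕ} (h : k ≤ Q) : bandLevel Q k = Q - k := by
  unfold bandLevel; omega

/-- The level on the positive side. [folklore] -/
theorem bandLevel_of_ge {Q k : ℕ} (h : Q ≤ k) : bandLevel Q k = k - Q := by
  unfold bandLevel; omega

/-- The start on the negative side and at the zero band. [folklore] -/
theorem bandStart_of_le (Δ : ℕ) {Q k : ℕ} (h : k ≤ Q) : bandStart Δ Q k = -(bLev Δ (Q - k) : ℤ) := if_pos h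

/-- The start on the positive side. [folklore] -/
theorem bandStart_of_lt (Δ : ℕ) {Q k : ℕ} (h : Q < k) : bandStart Δ Q k = (bLev Δ (k - Q - 1) : ℤ) + 1 :=
  if_neg (not_le.2 h)

/-- The zero band has length `1`. [folklore] -/
@[simp] theorem bandLen_zero (Δ : ℕ) : bandLen Δ 0 = 1 := if_pos rfl

/-- The bands of positive level. [folklore] -/
theorem bandLen_succ (Δ j : ℕ) : bandLen Δ (j + 1) = bLev Δ (j + 1) - bLev Δ j := by
  simp [bandLen]

/-- The first band starts at `−bLev Δ Q`. [folklore] -/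
theorem bandStart_zero (Δ Q : ℕ) : bandStart Δ Q 0 = -(bLev Δ Q : ℤ) := by
  simp [bandStart]

/-- **Consecutive bands are adjacent.** [folklore] -/
theorem bandStart_succ (Δ Q k : ℕ) (hk : k < 2 * Q) :
    bandStart Δ Q (k + 1) = bandStart Δ Q k + bandLen Δ (bandLevel Q k) := by
  rcases Nat.lt_or_ge k Q with h | h
  · -- the negative side, level `Q - k = j + 1`
    obtain ⟨j, rfl⟩ : ∃ j, Q = k + 1 + j := ⟨Q - (k + 1), by omega⟩
    rw [bandStart_of_le Δ (show k + 1 ≤ k + 1 + j by omega), bandStart_of_le Δ h.le, bandLevel_of_le h.le,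
      show k + 1 + j - (k + 1) = j from by omega, show k + 1 + j - k = j + 1 from by omega, bandLen_succ]
    have := bLev_mono Δ (Nat.le_succ j)
    push_cast [Nat.cast_sub this]
    ring
  · rcases h.eq_or_lt with rfl | h'
    · -- the zero band, `k = Q`
      rw [bandStart_of_lt Δ (Nat.lt_succ_self Q), bandStart_of_le Δ le_rfl, bandLevel_of_le le_rfl, Nat.sub_self,
        show Q + 1 - Q - 1 = 0 from by omega, bLev_zero, bandLen_zero]
      simp
    · -- the positive side, level `k - Q = j + 1`
      obtain ⟨j, rfl⟩ : ∃ j, k = Q + 1 + j := ⟨k - (Q + 1), by omega⟩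
      rw [bandStart_of_lt Δ (show Q < Q + 1 + j + 1 by omega), bandStart_of_lt Δ h', bandLevel_of_ge h,
        show Q + 1 + j + 1 - Q - 1 = j + 1 from by omega, show Q + 1 + j - Q - 1 = j from by omega,
        show Q + 1 + j - Q = j + 1 from by omega, bandLen_succ]
      have := bLev_mono Δ (Nat.le_succ j)
      push_cast [Nat.cast_sub this]
      ring

/-- **The last band ends at `bLev Δ Q`.** [folklore] -/
theorem bandStart_last (Δ Q : ℕ) :
    bandStart Δ Q (2 * Q) + bandLen Δ (bandLevel Q (2 * Q)) = (bLev Δ Q : ℤ) + 1 := by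
  rcases Nat.eq_zero_or_pos Q with rfl | hQ
  · simp [bandStart, bandLevel]
  · obtain ⟨j, rfl⟩ : ∃ j, Q = j + 1 := ⟨Q - 1, by omega⟩
    rw [bandStart_of_lt Δ (show j + 1 < 2 * (j + 1) by omega), bandLevel_of_ge (by omega),
      show 2 * (j + 1) - (j + 1) - 1 = j from by omega, show 2 * (j + 1) - (j + 1) = j + 1 from by omega,
      bandLen_succ]
    have := bLev_mono Δ (Nat.le_succ j)
    push_cast [Nat.cast_sub this]
    ring

/-- **Each band has constant weight, equal to its level.** [folklore] -/
theorem qWeight_bandStart_add {Δ : ℕ} (hΔ : 0 < Δ) (Q : ℕ) {k o : ℕ} (hk : k ≤ 2 * Q)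
    (ho : o < bandLen Δ (bandLevel Q k)) : qWeight Δ (bandStart Δ Q k + o) = bandLevel Q k := by
  rcases Nat.lt_or_ge k Q with h | h
  · -- negative side, level `Q - k = j + 1`
    obtain ⟨j, rfl⟩ : ∃ j, Q = k + 1 + j := ⟨Q - (k + 1), by omega⟩
    have e1 : k + 1 + j - k = j + 1 := by omega
    rw [bandLevel_of_le h.le, e1, bandLen_succ] at ho
    rw [bandStart_of_le Δ h.le, bandLevel_of_le h.le, e1, qWeight_eq_succ_iff hΔ]
    have hmono := bLev_mono Δ (Nat.le_succ j)
    have habs : (-(bLev Δ (j + 1) : ℤ) + o).natAbs = bLev Δ (j + 1) - o := by omega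
    rw [habs]
    omega
  · rcases h.eq_or_lt with rfl | h'
    · -- the zero band
      rw [bandLevel_of_le le_rfl, Nat.sub_self, bandLen_zero] at ho
      rw [bandStart_of_le Δ le_rfl, bandLevel_of_le le_rfl, Nat.sub_self, qWeight_eq_zero_iff hΔ, bLev_zero]
      omega
    · -- positive side, level `k - Q = j + 1`
      obtain ⟨j, rfl⟩ : ∃ j, k = Q + 1 + j := ⟨k - (Q + 1), by omega⟩
      have e1 : Q + 1 + j - Q = j + 1 := by omega
      rw [bandLevel_of_ge h, e1, bandLen_succ] at ho
      rw [bandStart_of_lt Δ h', bandLevel_of_ge h, show Q + 1 + j - Q - 1 = j from by omega, e1,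
        qWeight_eq_succ_iff hΔ]
      have habs : ((bLev Δ j : ℤ) + 1 + o).natAbs = bLev Δ j + 1 + o := by omega
      rw [habs]
      omega

/-! ### `below` along the bands -/

/-- One step of `below`: passing `v` adds the size of the fibre over `v` (if admissible). [folklore] -/
theorem below_add_one {Δ : ℕ} (hΔ : 0 < Δ) (m Q : ℕ) (v : ℤ) :
    below Δ m Q (v + 1) = below Δ m Q v + if qWeight Δ v ≤ Q then (qBall m (Q - qWeight Δ v) Δ).card else 0 := by
  rw [below, below, sum_filter, sum_filter]
  have hsplit : ∀ w ∈ adm Q Δ, (if w < v + 1 then (qBall m (Q - qWeight Δ w) Δ).card else 0) =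
      (if w < v then (qBall m (Q - qWeight Δ w) Δ).card else 0) +
        (if w = v then (qBall m (Q - qWeight Δ w) Δ).card else 0) := by
    intro w _
    rcases lt_trichotomy w v with h | rfl | h
    · rw [if_pos (by omega), if_pos h, if_neg h.ne, Nat.add_zero]
    · rw [if_pos (by omega), if_neg (lt_irrefl _), if_pos rfl, Nat.zero_add]
    · rw [if_neg (by omega), if_neg (by omega), if_neg h.ne']
  rw [sum_congr rfl hsplit, sum_add_distrib, sum_ite_eq' (adm Q Δ) v]
  simp only [mem_adm_iff hΔ]

/-- `below` over a stretch of constant weight `j ≤ Q` grows linearly, with slope the fibre size. [folklore] -/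
theorem below_add_of_qWeight_eq {Δ : ℕ} (hΔ : 0 < Δ) (m Q : ℕ) (v : ℤ) {j : ℕ} (hj : j ≤ Q) :
    ∀ o : ℕ, (∀ o' < o, qWeight Δ (v + (o' : ℕ)) = j) →
      below Δ m Q (v + o) = below Δ m Q v + o * (qBall m (Q - j) Δ).card
  | 0, _ => by simp
  | o + 1, h => by
      have ih := below_add_of_qWeight_eq hΔ m Q v hj o fun o' ho' => h o' (by omega)
      have hlast := h o (Nat.lt_succ_self o)
      rw [Nat.cast_succ, ← add_assoc, below_add_one hΔ, ih, hlast, if_pos hj]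
      ring

/-- Nothing lies below the first admissible coordinate. [folklore] -/
theorem below_neg_bLev (Δ m Q : ℕ) : below Δ m Q (-(bLev Δ Q : ℤ)) = 0 := by
  rw [below]
  refine sum_eq_zero fun w hw => ?_
  simp only [mem_filter, adm, Finset.mem_Icc] at hw
  omega

/-- The size of the `k`-th band of `qBall (m+1) Q Δ`: its length times its fibre size. [folklore] -/
def bandCard (Δ m Q k : ℕ) : ℕ := bandLen Δ (bandLevel Q k) * (qBall m (Q - bandLevel Q k) Δ).card

/-- **`below` at the start of the `k`-th band** is the total size of the earlier bands. [folklore] -/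
theorem below_bandStart {Δ : ℕ} (hΔ : 0 < Δ) (m Q : ℕ) :
    ∀ k, k ≤ 2 * Q → below Δ m Q (bandStart Δ Q k) = ((List.range k).map (bandCard Δ m Q)).sum
  | 0, _ => by rw [bandStart_zero, below_neg_bLev]; simp
  | k + 1, hk => by
      rw [bandStart_succ Δ Q k (by omega), List.range_succ, List.map_append, List.sum_append, List.map_singleton,
        List.sum_singleton, ← below_bandStart hΔ m Q k (by omega), bandCard]
      exact below_add_of_qWeight_eq hΔ m Q _ (bandLevel_le (by omega)) _ fun o' ho' =>
        qWeight_bandStart_add hΔ Q (by omega) ho'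

/-- **`below` inside the `k`-th band** is an arithmetic progression. [folklore] -/
theorem below_bandStart_add {Δ : ℕ} (hΔ : 0 < Δ) (m Q : ℕ) {k o : ℕ} (hk : k ≤ 2 * Q)
    (ho : o ≤ bandLen Δ (bandLevel Q k)) :
    below Δ m Q (bandStart Δ Q k + o) =
      ((List.range k).map (bandCard Δ m Q)).sum + o * (qBall m (Q - bandLevel Q k) Δ).card := by
  rw [← below_bandStart hΔ m Q k hk]
  exact below_add_of_qWeight_eq hΔ m Q _ (bandLevel_le hk) _ fun o' ho' =>
    qWeight_bandStart_add hΔ Q hk (by omega)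

/-- **The grouped counting recursion**: `|qBall (m+1) Q Δ|` is the total size of the `2Q + 1` bands,
`∑_{k ≤ 2Q} bandLen Δ (level k) · |qBall m (Q − level k) Δ|`. [folklore] -/
theorem card_qBall_succ_eq_sum_bandCard {Δ : ℕ} (hΔ : 0 < Δ) (m Q : ℕ) :
    (qBall (m + 1) Q Δ).card = ((List.range (2 * Q + 1)).map (bandCard Δ m Q)).sum := by
  rw [List.range_succ, List.map_append, List.sum_append, List.map_singleton, List.sum_singleton,
    ← below_bandStart hΔ m Q (2 * Q) le_rfl, bandCard,
    ← below_add_of_qWeight_eq hΔ m Q _ (bandLevel_le le_rfl) _ (fun o' ho' => qWeight_bandStart_add hΔ Q le_rfl ho'),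
    bandStart_last, card_qBall_succ hΔ, below, sum_filter]
  refine sum_congr rfl fun w hw => ?_
  rw [if_pos]
  simp only [adm, Finset.mem_Icc] at hw
  omega

/-! ### The counting dynamic programme -/

/-- **The counting table** `qCount Δ m Q = |qBall m Q Δ|`, by the grouped recursion over the bands
of the first coordinate: `qCount Δ 0 Q = 1`,
`qCount Δ (m+1) Q = ∑_{k ≤ 2Q} bandLen Δ (level k) · qCount Δ m (Q − level k)`. [folklore] -/
def qCount (Δ : ℕ) : ℕ → ℕ → ℕ
  | 0, _ => 1
  | m + 1, Q => ((List.range (2 * Q + 1)).map fun k => bandLen Δ (bandLevel Q k) * qCount Δ m (Q - bandLevel Q k)).sum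

/-- The recursion at `0`. [folklore] -/
@[simp] theorem qCount_zero (Δ Q : ℕ) : qCount Δ 0 Q = 1 := rfl

/-- The recursion at a successor. [folklore] -/
theorem qCount_succ (Δ m Q : ℕ) : qCount Δ (m + 1) Q =
    ((List.range (2 * Q + 1)).map fun k => bandLen Δ (bandLevel Q k) * qCount Δ m (Q - bandLevel Q k)).sum := rfl

/-- **Correctness of the counting table.** [folklore] -/
theorem qCount_eq_card {Δ : ℕ} (hΔ : 0 < Δ) : ∀ m Q, qCount Δ m Q = (qBall m Q Δ).card
  | 0, Q => by rw [qCount_zero, card_qBall_zero]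
  | m + 1, Q => by
      rw [qCount_succ, card_qBall_succ_eq_sum_bandCard hΔ]
      congr 1
      refine List.map_congr_left fun k _ => ?_
      rw [bandCard, qCount_eq_card hΔ m]

/-- The entries of the table are positive (`0 ∈ qBall`). [folklore] -/
theorem qCount_pos {Δ : ℕ} (hΔ : 0 < Δ) (m Q : ℕ) : 0 < qCount Δ m Q := by
  rw [qCount_eq_card hΔ]
  exact lt_of_lt_of_le (Nat.one_le_two_pow) (two_pow_kappa_le m Q Δ hΔ)

/-- The entries of the table are at most `(2 bLev Δ Q + 1)^m ≤ (2QΔ + 1)^m` (polynomially many bits). [folklore] -/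
theorem qCount_le_pow {Δ : ℕ} (hΔ : 0 < Δ) (m Q : ℕ) : qCount Δ m Q ≤ (2 * bLev Δ Q + 1) ^ m := by
  rw [qCount_eq_card hΔ, qBall]
  refine (card_filter_le _ _).trans ?_
  rw [Fintype.card_piFinset, prod_const, card_univ, Fintype.card_fin, Int.card_Icc]
  apply Nat.pow_le_pow_left
  rw [bLev]
  omega

/-! ### Unranking -/

/-- The sizes of the `2Q + 1` bands of `qBall (m+1) Q Δ`, from the counting table. [folklore] -/
def bandSizes (Δ m Q : ℕ) : List ℕ :=
  (List.range (2 * Q + 1)).map fun k => bandLen Δ (bandLevel Q k) * qCount Δ m (Q - bandLevel Q k)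

/-- The band sizes are the `bandCard`s. [folklore] -/
theorem bandSizes_eq {Δ : ℕ} (hΔ : 0 < Δ) (m Q : ℕ) : bandSizes Δ m Q = (List.range (2 * Q + 1)).map (bandCard Δ m Q) :=
  List.map_congr_left fun k _ => by rw [bandCard, qCount_eq_card hΔ]

/-- The entries of `bandSizes`. [folklore] -/
theorem bandSizes_getD {Δ : ℕ} (hΔ : 0 < Δ) (m Q : ℕ) {k : ℕ} (hk : k < 2 * Q + 1) :
    (bandSizes Δ m Q).getD k 0 = bandCard Δ m Q k := by
  rw [bandSizes_eq hΔ, List.getD_eq_getElem?_getD, List.getElem?_map, List.getElem?_range hk]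
  rfl

/-- Partial sums of `bandSizes`. [folklore] -/
theorem sum_take_bandSizes {Δ : ℕ} (hΔ : 0 < Δ) (m Q : ℕ) {k : ℕ} (hk : k ≤ 2 * Q + 1) :
    ((bandSizes Δ m Q).take k).sum = ((List.range k).map (bandCard Δ m Q)).sum := by
  rw [bandSizes_eq hΔ, ← List.map_take, List.take_range, Nat.min_eq_left hk]

/-- The band sizes add up to `|qBall (m+1) Q Δ|`. [folklore] -/
theorem sum_bandSizes {Δ : ℕ} (hΔ : 0 < Δ) (m Q : ℕ) : (bandSizes Δ m Q).sum = (qBall (m + 1) Q Δ).card := by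
  rw [bandSizes_eq hΔ, card_qBall_succ_eq_sum_bandCard hΔ]

/-- The band index and the offset inside the band of the point of rank `i` (block unranking over
the band sizes). [folklore] -/
def bandOf (Δ m Q i : ℕ) : ℕ × ℕ := BudgetRegion.blockUnrank (bandSizes Δ m Q) i

/-- **What block unranking delivers**: a band `k ≤ 2Q`, an offset below the band size, and the
rank decomposition `i = (sizes of the earlier bands) + offset`. [folklore] -/
theorem bandOf_spec {Δ : ℕ} (hΔ : 0 < Δ) (m Q i : ℕ) (hi : i < (qBall (m + 1) Q Δ).card) :
    (bandOf Δ m Q i).1 ≤ 2 * Q ∧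
      (bandOf Δ m Q i).2 < bandLen Δ (bandLevel Q (bandOf Δ m Q i).1) * (qBall m (Q - bandLevel Q (bandOf Δ m Q i).1) Δ).card ∧
      ((List.range (bandOf Δ m Q i).1).map (bandCard Δ m Q)).sum + (bandOf Δ m Q i).2 = i := by
  obtain ⟨hk, hoff, hrank⟩ := BudgetRegion.blockUnrank_spec (bandSizes Δ m Q) i (by rw [sum_bandSizes hΔ]; exact hi)
  have hlen : (bandSizes Δ m Q).length = 2 * Q + 1 := by simp [bandSizes]
  rw [hlen] at hk
  rw [bandSizes_getD hΔ m Q hk] at hoff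
  rw [BudgetRegion.blockRank, sum_take_bandSizes hΔ m Q hk.le] at hrank
  exact ⟨Nat.le_of_lt_succ hk, hoff, hrank⟩

/-- **The explicit unranking of the quantised ball** (dimension by dimension): find the band of the
index among the `2Q + 1` bands of the first coordinate, divide the offset by the fibre size — the
quotient locates the coordinate inside the band, the remainder is the index in the fibre —, and
recurse with the remaining budget. Only the numbers `bLev Δ j`, `j ≤ Q`, and the table `qCount`
are used. [cite: Regev2004, Lemma 3.11 (preparation of |η⟩; here: exact unranking of the quantised variant)] -/
def unrank (Δ : ℕ) : (m : ℕ) → ℕ → ℕ → (Fin m → ℤ)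
  | 0, _, _ => fun i => i.elim0
  | m + 1, Q, i =>
      consV (bandStart Δ Q (bandOf Δ m Q i).1 +
          ((bandOf Δ m Q i).2 / qCount Δ m (Q - bandLevel Q (bandOf Δ m Q i).1) : ℕ))
        (unrank Δ m (Q - bandLevel Q (bandOf Δ m Q i).1)
          ((bandOf Δ m Q i).2 % qCount Δ m (Q - bandLevel Q (bandOf Δ m Q i).1)))

/-- The recursion of `unrank` at a successor. [folklore] -/
theorem unrank_succ (Δ m Q i : ℕ) : unrank Δ (m + 1) Q i =
    consV (bandStart Δ Q (bandOf Δ m Q i).1 +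
        ((bandOf Δ m Q i).2 / qCount Δ m (Q - bandLevel Q (bandOf Δ m Q i).1) : ℕ))
      (unrank Δ m (Q - bandLevel Q (bandOf Δ m Q i).1)
        ((bandOf Δ m Q i).2 % qCount Δ m (Q - bandLevel Q (bandOf Δ m Q i).1))) := rfl

/-- **Correctness of unranking**: for `i < |qBall m Q Δ|`, `unrank Δ m Q i` is the point of the
quantised ball of lexicographic rank `i`. [folklore] -/
theorem unrank_spec {Δ : ℕ} (hΔ : 0 < Δ) : ∀ m Q i, i < (qBall m Q Δ).card →
    unrank Δ m Q i ∈ qBall m Q Δ ∧ lexRank (qBall m Q Δ) (unrank Δ m Q i) = i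
  | 0, Q, i, hi => by
      rw [card_qBall_zero] at hi
      obtain rfl : i = 0 := by omega
      refine ⟨(mem_qBall_iff hΔ _).2 (by simp), ?_⟩
      rw [lexRank, Finset.card_eq_zero, filter_eq_empty_iff]
      intro y _ h
      have : y = unrank Δ 0 Q 0 := funext fun j => Fin.elim0 j
      rw [this] at h
      exact lt_irrefl _ h
  | m + 1, Q, i, hi => by
      obtain ⟨hk, hoff, hrank⟩ := bandOf_spec hΔ m Q i hi
      rw [unrank_succ]
      generalize hb : bandOf Δ m Q i = b at hk hoff hrank ⊢
      obtain ⟨k, off⟩ := b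
      simp only at hk hoff hrank ⊢
      rw [qCount_eq_card hΔ]
      generalize hj : bandLevel Q k = j at hoff ⊢
      have hjQ : j ≤ Q := hj ▸ bandLevel_le hk
      generalize hc : (qBall m (Q - j) Δ).card = c at hoff ⊢
      have hcpos : 0 < c := Nat.pos_of_ne_zero fun h => by
        rw [h, Nat.mul_zero] at hoff
        exact Nat.not_lt_zero _ hoff
      have ho : off / c < bandLen Δ j := (Nat.div_lt_iff_lt_mul hcpos).2 hoff
      have hi' : off % c < (qBall m (Q - j) Δ).card := by rw [hc]; exact Nat.mod_lt _ hcpos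
      obtain ⟨hmem, hrk⟩ := unrank_spec hΔ m (Q - j) (off % c) hi'
      have hw : qWeight Δ (bandStart Δ Q k + (off / c : ℕ)) = j := by
        rw [← hj] at ho ⊢
        exact qWeight_bandStart_add hΔ Q hk ho
      refine ⟨(consV_mem_qBall_iff hΔ Q _ _).2 ⟨hw ▸ hjQ, by rw [hw]; exact hmem⟩, ?_⟩
      rw [lexRank_qBall_consV hΔ m Q _ _ (hw ▸ hjQ), hw, hrk]
      have hbelow := below_bandStart_add hΔ m Q hk (o := off / c) (by rw [hj]; exact ho.le)
      rw [hj, hc] at hbelow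
      rw [hbelow, ← hrank, add_assoc, Nat.div_add_mod']

/-- `unrank` lands in the quantised ball. [folklore] -/
theorem unrank_mem {Δ : ℕ} (hΔ : 0 < Δ) {m Q i : ℕ} (hi : i < (qBall m Q Δ).card) : unrank Δ m Q i ∈ qBall m Q Δ :=
  (unrank_spec hΔ m Q i hi).1

/-- `unrank Δ m Q i` has rank `i`. [folklore] -/
theorem lexRank_unrank {Δ : ℕ} (hΔ : 0 < Δ) {m Q i : ℕ} (hi : i < (qBall m Q Δ).card) :
    lexRank (qBall m Q Δ) (unrank Δ m Q i) = i :=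
  (unrank_spec hΔ m Q i hi).2

/-- **`unrank` is `nthLex`**: the explicit unranking enumerates the quantised ball in lexicographic
order. [folklore] -/
theorem unrank_eq_nthLex {Δ : ℕ} (hΔ : 0 < Δ) {m Q i : ℕ} (hi : i < (qBall m Q Δ).card) :
    unrank Δ m Q i = nthLex (qBall m Q Δ) ⟨i, hi⟩ :=
  ((nthLex_eq_iff ⟨i, hi⟩ _).2 (unrank_spec hΔ m Q i hi)).symm

/-- `unrank` is injective on `[0, |qBall|)`. [folklore] -/
theorem unrank_injOn {Δ : ℕ} (hΔ : 0 < Δ) (m Q : ℕ) :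
    Set.InjOn (unrank Δ m Q) (Set.Iio (qBall m Q Δ).card) := fun i hi i' hi' h => by
  have := congrArg (lexRank (qBall m Q Δ)) h
  rwa [lexRank_unrank hΔ (Set.mem_Iio.1 hi), lexRank_unrank hΔ (Set.mem_Iio.1 hi')] at this

/-- **The quantised ball is the image of `[0, |qBall|)` under `unrank`.** [folklore] -/
theorem qBall_eq_image_unrank {Δ : ℕ} (hΔ : 0 < Δ) (m Q : ℕ) :
    qBall m Q Δ = (Finset.range (qBall m Q Δ).card).image (unrank Δ m Q) := by
  symm
  apply Finset.eq_of_subset_of_card_le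
  · intro x hx
    obtain ⟨i, hi, rfl⟩ := mem_image.1 hx
    exact unrank_mem hΔ (mem_range.1 hi)
  · rw [card_image_of_injOn (fun i hi i' hi' h => unrank_injOn hΔ m Q (by simpa using hi) (by simpa using hi') h),
      card_range]

/-- **The point set of a register is the image of `[0, 2^κ)` under `unrank`**: the state
`2^{-κ/2} ∑_{i < 2^κ} |unrank i⟩` is the uniform superposition over `pointSet n Q Δ`.
[cite: Regev2004, Lemma 3.11 (the state |η⟩, exact power-of-two variant)] -/
theorem pointSet_eq_image_unrank {Δ : ℕ} (hΔ : 0 < Δ) (m Q : ℕ) :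
    pointSet m Q Δ hΔ = (Finset.range (2 ^ kappa m Q Δ)).image (unrank Δ m Q) := by
  ext x
  rw [pointSet, mem_lexPrefix_iff, mem_image]
  constructor
  · rintro ⟨i, hi, rfl⟩
    exact ⟨i, mem_range.2 hi, unrank_eq_nthLex hΔ i.isLt⟩
  · rintro ⟨i, hi, rfl⟩
    have hi' : i < (qBall m Q Δ).card := lt_of_lt_of_le (mem_range.1 hi) (two_pow_kappa_le m Q Δ hΔ)
    exact ⟨⟨i, hi'⟩, mem_range.1 hi, (unrank_eq_nthLex hΔ hi').symm⟩

/-- Membership in the point set, by rank: `x ∈ pointSet ↔ x ∈ qBall ∧ lexRank x < 2^κ`. [folklore] -/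
theorem mem_pointSet_iff_lexRank {Δ : ℕ} (hΔ : 0 < Δ) (m Q : ℕ) (x : Fin m → ℤ) :
    x ∈ pointSet m Q Δ hΔ ↔ x ∈ qBall m Q Δ ∧ lexRank (qBall m Q Δ) x < 2 ^ kappa m Q Δ := by
  rw [pointSet, mem_lexPrefix_iff]
  constructor
  · rintro ⟨i, hi, rfl⟩
    exact ⟨nthLex_mem _ i, by rwa [lexRank_nthLex]⟩
  · rintro ⟨hx, hr⟩
    exact ⟨⟨lexRank (qBall m Q Δ) x, lexRank_lt_card hx⟩, hr, nthLex_lexRank hx⟩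

/-- `2^κ` in terms of the counting table: `κ = ⌊log₂ qCount Δ n Q⌋`. [folklore] -/
theorem kappa_eq_log_qCount {Δ : ℕ} (hΔ : 0 < Δ) (m Q : ℕ) : kappa m Q Δ = Nat.log 2 (qCount Δ m Q) := by
  rw [kappa, qCount_eq_card hΔ]

end Regev2004

end Literature.Algebra.EuclideanLattices
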